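import Summits.PneNP.PneNP.Theorems.SymmetryBudgetNoHiddenOrderValueAndDefs
import Summits.PneNP.PneNP.Theorems.SymmetryBudgetNoHiddenOrderPerPathCGAdm
import Summits.PneNP.PneNP.Theorems.SymmetryBudgetNoHiddenOrderLexMinSocketDefs

/-!
# `NoHiddenOrder` (stmt-PneNP-14781), (R2c) VI: the window canoniser program — gate shapes and the gate type

Route `PneNP/SymmetryBudget`.  The concrete symmetric threshold program realising the certified-label scheme on the `⌊log₂ m⌋`-window of an
`m × m` matrix is assembled from the modules of (R2c) I–V.  This file fixes its INDEX DATA: the window vertex type `WV m` (the subtype of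
`windowSet m`), its size `wn m`, the admissible labels `FLab m` (`(U, X, λ)` with `λ < wn m` pointwise and `AdmB`, a finite type), and the GATE
TYPE `Gt m` — one constructor per gate family, grouped by gate SHAPES that mirror the module structures: `CCGate` (a `CmpCount`), `CTGate`
(a `CmpTwice`), `RIGate` (a `RefineIter` with value read-out, `RefVal`), `VCGate` (a `VecCmp`), `AnGate` (a `DAnalysis`), `TrGate` (a transition of
`Decode`), `OrGate` (a `VOr`), `AndGate` (a `VAnd`), `VlGate` (a `Value`), plus the root gates (constants, adjacency, signature comparison, root
refinement) and the output layer.  Kinds, sources and ranks are in `…ProgramSrcs.lean`.  Definitions only; supports stmt-PneNP-14781.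
-/

set_option linter.dupNamespace false -- `Summit.PneNP.PneNP.…` (D-0017 single-conjunct layout)
set_option synthInstance.maxSize 4096 -- `deriving Fintype` on wide gate-shape inductives
set_option synthInstance.maxHeartbeats 400000

namespace Summit.PneNP.PneNP.Theorems

open Finset CGBits BranchSum

namespace WCanon

/-! ### The window -/

/-- The WINDOW VERTEX TYPE at size `m`: the indices not fixed by the budget. [folklore] -/
abbrev WV (m : ℕ) : Type := {a : Fin m // a ∈ windowSet m}

/-- The window size. [folklore] -/
def wn (m : ℕ) : ℕ := (windowSet m).card

/-- The window vertex type has `wn m` elements. [folklore] -/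
theorem card_WV (m : ℕ) : Fintype.card (WV m) = wn m := Fintype.card_coe _

/-- The admissibility bound `4|V| + ⌊log₂ |V|⌋` of `AdmB`. [folklore] -/
def Bw (m : ℕ) : ℕ := 4 * wn m + Nat.log 2 (wn m)

/-! ### Admissible labels -/

/-- **The admissible labels**: `(U, X, λ)` with `λ < wn m` pointwise (as `Fin`) and `AdmB (Bw m) X λ`. [folklore] -/
abbrev FLab (m : ℕ) : Type :=
  {L : Finset (WV m) × Finset (WV m) × (WV m → Fin (wn m)) // AdmB (Bw m) L.2.1 fun v => (L.2.2 v : ℕ)}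

/-- The label of the scheme denoted by an admissible label. [folklore] -/
def toLab {m : ℕ} (L : FLab m) : CertifiedLabels.Label (WV m) := ⟨L.1.1, L.1.2.1, fun v => (L.1.2.2 v : ℕ)⟩

open scoped Classical in
/-- Reading a label of the scheme back as an admissible label, if it is one. [folklore] -/
noncomputable def ofLab {m : ℕ} (L : CertifiedLabels.Label (WV m)) : Option (FLab m) :=
  if h : (∀ v, L.lam v < wn m) ∧ AdmB (Bw m) L.X L.lam then
    some ⟨(L.U, L.X, fun v => ⟨L.lam v, h.1 v⟩), h.2⟩
  else none

/-- The admissibility predicate of the scheme. [folklore] -/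
def admW (m : ℕ) (L : CertifiedLabels.Label (WV m)) : Prop := AdmB (Bw m) L.X L.lam

/-- `admW` is decidable. -/
instance (m : ℕ) : DecidablePred (admW m) := fun L => by unfold admW; infer_instance

/-! ### Gate shapes -/

/-- The count bound: `|V|²`. [folklore] -/
def pN (m : ℕ) : ℕ := wn m * wn m

/-- The number of walk stages: `2|V|`. [folklore] -/
def pF (m : ℕ) : ℕ := wn m + wn m

/-- Shape of a `CmpCount` gadget (thresholds `θ : Fin (N + 1)`). [folklore] -/
inductive CCGate (m : ℕ)
  /-- `geA θ` -/ | geA (θ : Fin (pN m + 1))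
  /-- `geB θ` -/ | geB (θ : Fin (pN m + 1))
  /-- `ngeA θ` -/ | ngeA (θ : Fin (pN m + 1))
  /-- `both θ` -/ | both (θ : Fin (pN m + 1))
  /-- `none θ` -/ | none (θ : Fin (pN m + 1))
  /-- `eqv θ` -/ | eqv (θ : Fin (pN m + 1))
  /-- `eq` -/ | eq
  /-- `ltw θ` -/ | ltw (θ : Fin (pN m + 1))
  /-- `lt` -/ | lt
  deriving DecidableEq, Fintype

/-- Shape of a `CmpTwice` gadget. [folklore] -/
inductive CTGate (m : ℕ)
  /-- `ge2A θ` -/ | ge2A (θ : Fin (pN m + 1))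
  /-- `geB θ` -/ | geB (θ : Fin (pN m + 1))
  /-- `nge2A θ` -/ | nge2A (θ : Fin (pN m + 1))
  /-- `tww θ` -/ | tww (θ : Fin (pN m + 1))
  /-- `tw` -/ | tw
  deriving DecidableEq, Fintype

/-- Shape of a `RefineIter` of `T` rounds with value read-out (`RefVal`, values `< D`). [folklore] -/
inductive RIGate (m : ℕ)
  /-- round `r`: `c u w y` -/ | c (r : Fin (wn m)) (u w y : WV m)
  /-- round `r`: count comparison gates -/ | cmp (r : Fin (wn m)) (u v w : WV m) (g : CCGate m)
  /-- `nmem w` -/ | nmem (w : WV m)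
  /-- round `r`: `nlt w' w` -/ | nlt (r : Fin (wn m)) (w' w : WV m)
  /-- round `r`: `pre u v w w'` -/ | pre (r : Fin (wn m)) (u v w w' : WV m)
  /-- round `r`: `allpre u v w` -/ | allpre (r : Fin (wn m)) (u v w : WV m)
  /-- round `r`: `wit u v w` -/ | wit (r : Fin (wn m)) (u v w : WV m)
  /-- round `r`: `prof u v` -/ | prof (r : Fin (wn m)) (u v : WV m)
  /-- round `r`: `tie u v` -/ | tie (r : Fin (wn m)) (u v : WV m)
  /-- round `r`: output order -/ | ltS (r : Fin (wn m)) (u v : WV m)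
  /-- round `r`: output kernel -/ | eqS (r : Fin (wn m)) (u v : WV m)
  /-- value read-out: `c w v` -/ | vc (w v : WV m)
  /-- value read-out: `ge v t` -/ | vge (v : WV m) (t : Fin (wn m + 1))
  /-- value read-out: `nge v t` -/ | vnge (v : WV m) (t : Fin (wn m + 1))
  /-- value read-out: `inA v t` -/ | vinA (v : WV m) (t : Fin (wn m))
  /-- value read-out: `nm v` -/ | vnm (v : WV m)
  /-- value read-out: OUTPUT `val v t` -/ | vval (v : WV m) (t : Fin (wn m))
  deriving DecidableEq, Fintype

/-- Shape of the signature `VecCmp` (owners the window vertices, vectors of length `m + m`). [folklore] -/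
inductive VSGate (m : ℕ)
  /-- `both k k' j` -/ | both (k k' : WV m) (j : Fin (m + m))
  /-- `none k k' j` -/ | none (k k' : WV m) (j : Fin (m + m))
  /-- `eqv k k' j` -/ | eqv (k k' : WV m) (j : Fin (m + m))
  /-- `nb k j` -/ | nb (k : WV m) (j : Fin (m + m))
  /-- `lt k k' j` -/ | lt (k k' : WV m) (j : Fin (m + m))
  /-- OUTPUT `less k k'` -/ | less (k k' : WV m)
  /-- OUTPUT `eqall k k'` -/ | eqall (k k' : WV m)
  deriving DecidableEq, Fintype

/-- Shape of the candidates' `VecCmp` (owners `V × Fin n`, vectors of length `NB n`). [folklore] -/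
inductive VOGate (m : ℕ)
  /-- `both` -/ | both (k k' : WV m × Fin (wn m)) (j : Fin (NB (wn m)))
  /-- `none` -/ | none (k k' : WV m × Fin (wn m)) (j : Fin (NB (wn m)))
  /-- `eqv` -/ | eqv (k k' : WV m × Fin (wn m)) (j : Fin (NB (wn m)))
  /-- `nb` -/ | nb (k : WV m × Fin (wn m)) (j : Fin (NB (wn m)))
  /-- `lt` -/ | lt (k k' : WV m × Fin (wn m)) (j : Fin (NB (wn m)))
  /-- OUTPUT `less` -/ | less (k k' : WV m × Fin (wn m))
  /-- OUTPUT `eqall` -/ | eqall (k k' : WV m × Fin (wn m))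
  deriving DecidableEq, Fintype

/-- Shape of the parts' `VecCmp` (owners `Finset V`, vectors of length `NB n`). [folklore] -/
inductive VAGate (m : ℕ)
  /-- `both` -/ | both (k k' : Finset (WV m)) (j : Fin (NB (wn m)))
  /-- `none` -/ | none (k k' : Finset (WV m)) (j : Fin (NB (wn m)))
  /-- `eqv` -/ | eqv (k k' : Finset (WV m)) (j : Fin (NB (wn m)))
  /-- `nb` -/ | nb (k : Finset (WV m)) (j : Fin (NB (wn m)))
  /-- `lt` -/ | lt (k k' : Finset (WV m)) (j : Fin (NB (wn m)))
  /-- OUTPUT `less` -/ | less (k k' : Finset (WV m))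
  /-- OUTPUT `eqall` -/ | eqall (k k' : Finset (WV m))
  deriving DecidableEq, Fintype

/-- Shape of a `DAnalysis` (analysis of a walk state; `Reach` rounds `i`, values `< D`). [folklore] -/
inductive AnGate (m : ℕ)
  /-- `ValOrd.pr` -/ | oPr (u v : WV m) (c c' : Fin (wn m))
  /-- `ValOrd.lt` -/ | oLt (u v : WV m)
  /-- `ValOrd.eq` -/ | oEq (u v : WV m)
  /-- `Switching.pr` -/ | swPr (u v a b : WV m)
  /-- `Switching.apr` -/ | swApr (u v a b : WV m)
  /-- `Switching.twice` -/ | swTw (u v : WV m) (g : CTGate m)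
  /-- `Switching.nadj` -/ | swNadj (u v : WV m)
  /-- `Switching.ntw` -/ | swNtw (u v : WV m)
  /-- `Switching.kept` -/ | swKept (u v : WV m)
  /-- `Switching.added` -/ | swAdded (u v : WV m)
  /-- `Switching.sw'` -/ | swSw' (u v : WV m)
  /-- `Switching.sw` -/ | swSw (u v : WV m)
  /-- `Reach.e` -/ | rE (u v : WV m)
  /-- `Reach.mid` -/ | rMid (i : Fin (wn m)) (u w v : WV m)
  /-- `Reach.r` -/ | rR (i : Fin (wn m + 1)) (u v : WV m)
  /-- `MinCell.cy` -/ | mcCy (u y : WV m)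
  /-- `MinCell.big` -/ | mcBig (u : WV m)
  /-- `MinCell.cmp` -/ | mcCmp (v u : WV m) (g : CCGate m)
  /-- `MinCell.tieLT` -/ | mcTieLT (v u : WV m)
  /-- `MinCell.bo` -/ | mcBo (v u : WV m)
  /-- `MinCell.better` -/ | mcBetter (v u : WV m)
  /-- `MinCell.nobetter` -/ | mcNobetter (u : WV m)
  /-- `MinCell.sel` -/ | mcSel (u : WV m)
  /-- `nmem` -/ | nmem (v : WV m)
  /-- `ncons` -/ | ncons (v : WV m)
  /-- `cov` -/ | cov (u w : WV m)
  /-- `all` -/ | all (u : WV m)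
  /-- `nall` -/ | nall (u : WV m)
  /-- `disc` -/ | disc (u : WV m)
  /-- `isAND` -/ | isAND
  /-- `nisAND` -/ | nisAND
  /-- `big2` -/ | big2
  /-- `nbig2` -/ | nbig2
  /-- `isOR` -/ | isOR
  /-- `stop` -/ | stop
  /-- `frozen` -/ | frozen
  /-- `nfrozen` -/ | nfrozen
  /-- `cand` -/ | cand (y : WV m)
  /-- `ncand` -/ | ncand (y : WV m)
  /-- `dom` -/ | dom (y : WV m)
  /-- `ndom` -/ | ndom (y : WV m)
  /-- `go` -/ | go
  /-- `ngo` -/ | ngo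
  /-- `andok` -/ | andok
  /-- `nandok` -/ | nandok
  deriving DecidableEq, Fintype

/-- Shape of a transition of `Decode` (the `RefVal` of the stage is `rv`). [folklore] -/
inductive TrGate (m : ℕ)
  /-- `tieD` -/ | tieD (u v : WV m)
  /-- `ltI` -/ | ltI (u v : WV m)
  /-- `bothD` -/ | bothD (u v : WV m)
  /-- `noneD` -/ | noneD (u v : WV m)
  /-- `deqv` -/ | deqv (u v : WV m)
  /-- `eqI` -/ | eqI (u v : WV m)
  /-- the refinement with value read-out -/ | rv (g : RIGate m)
  /-- `takeAnd` -/ | takeAnd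
  /-- `ntakeAnd` -/ | ntakeAnd
  /-- `takeOr` -/ | takeOr
  /-- `ntakeOr` -/ | ntakeOr
  /-- `newMem` -/ | newMem (w : WV m)
  /-- `m1` -/ | m1 (v : WV m)
  /-- `m2` -/ | m2 (v : WV m)
  /-- `mx` -/ | mx (v : WV m)
  /-- `v1` -/ | v1 (v : WV m) (c : Fin (wn m))
  /-- `v2` -/ | v2 (v : WV m) (c : Fin (wn m))
  /-- `vx` -/ | vx (v : WV m) (c : Fin (wn m))
  /-- `c1` -/ | c1 (v : WV m)
  /-- `cx` -/ | cx (v : WV m)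
  /-- `d1` -/ | d1
  /-- `d2` -/ | d2
  /-- `d3` -/ | d3
  /-- `dx` -/ | dx
  deriving DecidableEq, Fintype

/-- Shape of a `VOr` (candidates `κ : V × Fin n`; the refinement at the static vertex `y` is `rv y`). [folklore] -/
inductive OrGate (m : ℕ)
  /-- `ltx` -/ | ltx (y u v : WV m)
  /-- `eqx` -/ | eqx (y u v : WV m)
  /-- `RVc y` -/ | rv (y : WV m) (g : RIGate m)
  /-- `bothc` -/ | bothc (κ : WV m × Fin (wn m)) (w : WV m) (c : Fin (wn m))
  /-- `nonec` -/ | nonec (κ : WV m × Fin (wn m)) (w : WV m) (c : Fin (wn m))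
  /-- `xnc` -/ | xnc (κ : WV m × Fin (wn m)) (w : WV m) (c : Fin (wn m))
  /-- `eqc` -/ | eqc (κ : WV m × Fin (wn m))
  /-- `kept` -/ | kept (κ : WV m × Fin (wn m))
  /-- `cmu` -/ | cmu (y : WV m) (c' c : Fin (wn m)) (u : WV m)
  /-- `cm` -/ | cm (y : WV m) (c' c : Fin (wn m))
  /-- `lc` -/ | lc (κ : WV m × Fin (wn m)) (i c' c : Fin (wn m))
  /-- `liftC` -/ | liftC (κ : WV m × Fin (wn m)) (i c : Fin (wn m))
  /-- the comparison of lifted values -/ | vc (g : VOGate m)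
  /-- `beat` -/ | beat (κ' κ : WV m × Fin (wn m))
  /-- `nbeat` -/ | nbeat (κ' κ : WV m × Fin (wn m))
  /-- `best` -/ | best (κ : WV m × Fin (wn m))
  /-- OUTPUT `orOk` -/ | orOk
  /-- `ob` -/ | ob (κ : WV m × Fin (wn m)) (b : Fin (NB (wn m)))
  /-- OUTPUT `orBit` -/ | orBit (b : Fin (NB (wn m)))
  deriving DecidableEq, Fintype

/-- Shape of a `VAnd` (part blocks `U' : Finset V`). [folklore] -/
inductive AndGate (m : ℕ)
  /-- `nreach` -/ | nreach (u w : WV m)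
  /-- `partAt` -/ | partAt (u : WV m) (U' : Finset (WV m))
  /-- `isPart` -/ | isPart (U' : Finset (WV m))
  /-- `nisPart` -/ | nisPart (U' : Finset (WV m))
  /-- `imp` -/ | imp (U' : Finset (WV m))
  /-- OUTPUT `andOk` -/ | andOk
  /-- the comparison of part values -/ | vc (g : VAGate m)
  /-- `pg` -/ | pg (U' U'' : Finset (WV m)) (u : WV m)
  /-- `cntGe` -/ | cntGe (U' : Finset (WV m)) (t : Fin (wn m + 2))
  /-- `ncntGe` -/ | ncntGe (U' : Finset (WV m)) (t : Fin (wn m + 2))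
  /-- `cntIs` -/ | cntIs (U' : Finset (WV m)) (t : Fin (wn m + 1))
  /-- `eqp` -/ | eqp (U' U'' : Finset (WV m))
  /-- `multGe` -/ | multGe (U' : Finset (WV m)) (q : Fin (wn m + 2))
  /-- `rowSrc` -/ | rowSrc (i : Fin (wn m)) (U' : Finset (WV m)) (t : Fin (wn m + 1))
  /-- `pcb` -/ | pcb (i c : Fin (wn m)) (U' : Finset (WV m)) (t : Fin (wn m + 1)) (o : Fin (wn m))
  /-- OUTPUT `pCol` -/ | pCol (i c : Fin (wn m))
  /-- `scp` -/ | scp (i j : Fin (wn m)) (U' : Finset (WV m)) (t : Fin (wn m + 1))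
  /-- `sameCopy` -/ | sameCopy (i j : Fin (wn m))
  /-- `nsame` -/ | nsame (i j : Fin (wn m))
  /-- `pab` -/ | pab (i j : Fin (wn m)) (U' : Finset (WV m)) (t : Fin (wn m + 1)) (o o' : Fin (wn m))
  /-- `pOwn` -/ | pOwn (i j : Fin (wn m))
  /-- `swu` -/ | swu (c c' : Fin (wn m)) (u w : WV m)
  /-- `swcc` -/ | swcc (c c' : Fin (wn m))
  /-- `xcp` -/ | xcp (i j c c' : Fin (wn m))
  /-- `xc` -/ | xc (i j : Fin (wn m))
  /-- `pX` -/ | pX (i j : Fin (wn m))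
  /-- OUTPUT `pAdj` -/ | pAdj (i j : Fin (wn m))
  deriving DecidableEq, Fintype

/-- Shape of the output gates of a `Value`. [folklore] -/
inductive VlGate (m : ℕ)
  /-- `ndead` -/ | ndead
  /-- `decOK` -/ | decOK
  /-- `a1` -/ | a1
  /-- `a2` -/ | a2
  /-- `okk` -/ | okk
  /-- OUTPUT `ok` -/ | ok
  /-- `b1` -/ | b1 (b : Fin (NB (wn m)))
  /-- `b2` -/ | b2 (b : Fin (NB (wn m)))
  /-- `bb` -/ | bb (b : Fin (NB (wn m)))
  /-- OUTPUT `bit` -/ | bit (b : Fin (NB (wn m)))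
  deriving DecidableEq, Fintype

/-! ### The gate type -/

/-- **The gate type of the window canoniser at size `m`.** [folklore] -/
inductive Gt (m : ℕ)
  /-- the constant `true` -/ | tt
  /-- the constant `false` -/ | ff
  /-- symmetrised adjacency of two window vertices -/ | adjW (u v : WV m)
  /-- symmetrised adjacency of a window vertex and an ordered index -/ | adjO (u : WV m) (b : Fin m)
  /-- comparison of signatures towards the ordered part -/ | sig (g : VSGate m)
  /-- the root refinement of the signature colouring, with value read-out -/ | root (g : RIGate m)
  /-- analysis of stage `k` of the walk of label `L` -/ | an (L : FLab m) (k : Fin (pF m + 1)) (g : AnGate m)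
  /-- transition of stage `k` of the walk of label `L` -/ | tr (L : FLab m) (k : Fin (pF m)) (g : TrGate m)
  /-- value of `L` at an individualisation node -/ | vor (L : FLab m) (g : OrGate m)
  /-- value of `L` at a section node -/ | vand (L : FLab m) (g : AndGate m)
  /-- value of `L` -/ | vl (L : FLab m) (g : VlGate m)
  /-- window × ordered output helper: row colour `c` at position `a`, vertex `u` of that colour adjacent to `b` -/
  | woc (a b : Fin m) (u : WV m) (c : Fin (wn m))
  /-- the output gate of entry `q` -/ | out (q : Fin m × Fin m)
  deriving DecidableEq, Fintype

end WCanon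

end Summit.PneNP.PneNP.Theorems
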